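import Literature.Analysis.FluidPDE.JiaSverak2013Lemma8Window
import Literature.Analysis.FluidPDE.LocalLerayPressureBoundTools
import Literature.Analysis.FluidPDE.LocalLeraySlabH1Pairing
import Literature.Analysis.UnboundedOperators.HeatKernelGradientSmoothing
import Mathlib.Analysis.SpecialFunctions.Integrals.Basic
import HarnessLib

/-!
# The lower-order remainder of the caloric layer estimate for a general smooth comparison field

Analysis/FluidPDE proof file (theorems only, no definitions, no named facts) on the way to the
discharge of `Literature.Analysis.FluidPDE.BarkerPrange2020_thm2` (Barker–Prange 2020, Thm. 2) by
compactness. The uniform local initial layer `‖u(t) - e^{tΔ}u₀‖_{L²(B(x₀,1))} ≤ η(t) → 0` for local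
energy solutions whose data are small in `L³` only on a large ball (and uniformly locally `L²`
outside) is proved along the lines of Jia–Šverák's Lemma 8 (`JiaSverak2013Lemma8*.lean`), with
the free evolution split into a near part (an `L³` caloric field, heat-kernel bounds) and a far
part (bounded with bounded gradient near `x₀`). This file supplies the analogue of
`Literature.Analysis.FluidPDE.remainder_integral_bound` (`JiaSverak2013Lemma8RemainderBound.lean`)
for an *arbitrary* jointly smooth comparison field `e` on `(0, ∞) × ℝ³` satisfying the three local
bounds on `B(x₀, 3)` that the Jia–Šverák proof actually uses —
`‖e(t)‖_{L³(B)} ≤ M`, `‖e(t)‖_{L⁶(B)} ≤ M₆ t^{-1/4}`, `‖∇e(t)‖_{L³(B)} ≤ M_g t^{-1/2}` (`0 < t ≤ 1`):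
the majorant

  `Ψ = c_Δ|w|² + 2c₁(|w|² + |e|²)|u| + 4c₁|p||w| + 2|De||e||w| + 2c₁|e|²|w| + 2c₁|e|³ + 4c₁|e||w|² + c₁²|w|²`

(`w = u - e`) has `∫_{(0,τ)×B(x₀,3)} Ψ ≤ a(τ)` with `a = a_{M,M₆,M_g,E,A,Π} ≥ 0` non-decreasing,
`a(τ) → 0` (`remainder_integral_bound_of_local_caloric_bounds`). The proof is the tree's proof of
`remainder_integral_bound` with the heat-kernel estimates turned into hypotheses (private
pointwise helpers are re-proved here because they are private there).

## References

* H. Jia, V. Šverák, SIAM J. Math. Anal. 45 (2013) 1448–1459 = arXiv:1201.1592, Lemma 8 (p. 7),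
  Cor. 1 (p. 4). [JiaSverak2013]
* T. Barker, C. Prange, Arch. Ration. Mech. Anal. 236 (2020) 1487–1541 = arXiv:1812.09115, Thm. 2,
  §4.2 (p. 16). [BarkerPrange2020]
-/

noncomputable section

open MeasureTheory TopologicalSpace Set Function Filter Metric InnerProductSpace
open _root_.Topology
open scoped ENNReal NNReal RealInnerProductSpace

namespace Literature.Analysis.FluidPDE

namespace BarkerPrange2020

section Tools

/-- `∫₀^τ t^{-3/4} dt = 4 τ^{1/4}` in `lintegral` form (private copy of
`Literature.Analysis.FluidPDE.lintegral_Ioo_rpow_neg_three_quarters`, whose file is not imported to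
keep this one independent of the `L³`-datum remainder file). [folklore] -/
private theorem lintegral_Ioo_rpow_neg_three_quarters' {τ : ℝ} (hτ : 0 ≤ τ) :
    ∫⁻ t in Ioo 0 τ, ENNReal.ofReal (t ^ (-(3 / 4 : ℝ))) = ENNReal.ofReal (4 * τ ^ (1 / 4 : ℝ)) := by
  have hint : IntervalIntegrable (fun t : ℝ => t ^ (-(3 / 4 : ℝ))) volume 0 τ :=
    intervalIntegral.intervalIntegrable_rpow' (by norm_num)
  have hI := integral_rpow (a := 0) (b := τ) (r := -(3 / 4 : ℝ)) (Or.inl (by norm_num))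
  have e1 : -(3 / 4 : ℝ) + 1 = 1 / 4 := by norm_num
  rw [e1, Real.zero_rpow (by norm_num), sub_zero, intervalIntegral.integral_of_le hτ] at hI
  rw [setLIntegral_congr Ioo_ae_eq_Ioc, ← ofReal_integral_eq_lintegral_ofReal hint.1
    ((ae_restrict_iff' measurableSet_Ioc).2 (Eventually.of_forall fun t ht =>
      Real.rpow_nonneg ht.1.le _)), hI]
  congr 1
  ring

end Tools

section Main

/-- `‖a - b‖³ ≤ 4‖a‖³ + 4‖b‖³` for the extended norms (the square analogue is
`Literature.Analysis.FluidPDE.enorm_sub_sq_le`, `NSWeakStrongUniqueness.lean`). [folklore] -/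
private theorem enorm_sub_pow_three_le {F : Type*} [NormedAddCommGroup F] (a b : F) :
    ‖a - b‖ₑ ^ 3 ≤ 4 * ‖a‖ₑ ^ 3 + 4 * ‖b‖ₑ ^ 3 := by
  have h : ‖a - b‖ ^ 3 ≤ 4 * ‖a‖ ^ 3 + 4 * ‖b‖ ^ 3 := by
    have h1 : ‖a - b‖ ^ 3 ≤ (‖a‖ + ‖b‖) ^ 3 := pow_le_pow_left₀ (norm_nonneg _) (norm_sub_le a b) 3
    nlinarith [sq_nonneg (‖a‖ - ‖b‖), norm_nonneg a, norm_nonneg b,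
      mul_nonneg (mul_nonneg (norm_nonneg a) (norm_nonneg b)) (add_nonneg (norm_nonneg a) (norm_nonneg b))]
  calc ‖a - b‖ₑ ^ 3 = ENNReal.ofReal (‖a - b‖ ^ 3) := by rw [← ofReal_norm, ENNReal.ofReal_pow (norm_nonneg _)]
    _ ≤ ENNReal.ofReal (4 * ‖a‖ ^ 3 + 4 * ‖b‖ ^ 3) := ENNReal.ofReal_le_ofReal h
    _ = 4 * ‖a‖ₑ ^ 3 + 4 * ‖b‖ₑ ^ 3 := by
        rw [ENNReal.ofReal_add (by positivity) (by positivity), ENNReal.ofReal_mul (by norm_num),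
          ENNReal.ofReal_mul (by norm_num), ENNReal.ofReal_pow (norm_nonneg _), ENNReal.ofReal_pow (norm_nonneg _),
          ofReal_norm, ofReal_norm, ENNReal.ofReal_ofNat]

/-- `∫⁻_B f ≤ (∫⁻_B f^{3/2})^{2/3} |B|^{1/3}` in the form `∫⁻_B ‖g‖ₑ² ≤ (∫⁻_B ‖g‖ₑ³)^{2/3} |B|^{1/3}`
(Hölder with exponents `(3/2, 3)` against the constant `1`). [folklore] -/
private theorem lintegral_enorm_sq_le_cube_rpow {X F : Type*} [MeasurableSpace X] {μ : Measure X}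
    [NormedAddCommGroup F] [MeasurableSpace F] [BorelSpace F] {g : X → F} (hg : AEStronglyMeasurable g μ) :
    ∫⁻ x, ‖g x‖ₑ ^ 2 ∂μ ≤ (∫⁻ x, ‖g x‖ₑ ^ 3 ∂μ) ^ (2 / 3 : ℝ) * (μ univ) ^ (1 / 3 : ℝ) := by
  have h := lintegral_mul_le_L32_L3 (μ := μ) (f := fun x => ‖g x‖ₑ ^ 2) (g := fun _ => 1)
    (hg.aemeasurable.enorm.pow_const _) aemeasurable_const
  simp only [mul_one, one_pow, lintegral_const, one_mul] at h
  have e : ∀ x, (‖g x‖ₑ ^ 2) ^ (3 / 2 : ℝ) = ‖g x‖ₑ ^ 3 := fun x => by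
    rw [← ENNReal.rpow_natCast _ 2, ← ENNReal.rpow_mul, ← ENNReal.rpow_natCast _ 3]; norm_num
  simp only [e] at h
  exact h

set_option maxHeartbeats 6400000 in
/-- **The lower-order remainder of the windowed energy bound is `o(1)`, uniformly, for any smooth
comparison field with the local caloric bounds.** The statement of
`Literature.Analysis.FluidPDE.remainder_integral_bound` (Jia–Šverák 2013, proof of Lemma 8) with the
free evolution `e^{tΔ}u₀` of an `L³` datum replaced by an arbitrary field `e`, jointly smooth on
`(0, ∞) × ℝ³`, of which only the three *local* bounds on the ball `B(x₀, 3)` that the proof uses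
are assumed: `‖e(t)‖_{L³(B)} ≤ M`, `‖e(t)‖_{L⁶(B)} ≤ M₆ t^{-1/4}`, `‖∇e(t)‖_{L³(B)} ≤ M_g t^{-1/2}`
for `0 < t ≤ 1`. For all nonnegative parameters `M, M₆, M_g, E, A, Π` and cut-off constants
`c₁, c_Δ ≥ 0` there is `a : ℝ → ℝ`, `a ≥ 0` non-decreasing, `a(τ) → 0` as `τ → 0⁺`, such that for
every local Leray solution `(u, p)` on a slab `(0,T) × ℝ³`, every weak spatial gradient `G`, every
such `e` and centre `x₀` with the cylinder bounds `∫_{B(x₀,3)}|u(t)|² ≤ E` (a.e. `t < T`),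
`∫∫_{(0,T)×B(x₀,3)} |G|² ≤ A`, `∫∫_{(0,T)×B(x₀,3)} |p|^{3/2} ≤ Π`, and every `0 < τ ≤ min(T, 1)`,
the majorant `Ψ` (module docstring) is integrable on `(0,τ) × B(x₀,3)` with `∫ Ψ ≤ a(τ)`. This is
the form needed for data that are only *locally* in `L³` (Barker–Prange 2020, Thm. 2, where the
far field of the datum is merely uniformly locally square integrable and its caloric extension is
bounded with bounded gradient near the centre); the proof is that of `remainder_integral_bound`
verbatim, the heat-kernel estimates being now hypotheses.
[cite: JiaSverak2013, Lemma 8, proof (arXiv:1201.1592 p. 7); BarkerPrange2020, §4.2 (arXiv:1812.09115 p. 16)] -/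
theorem remainder_integral_bound_of_local_caloric_bounds (M M₆ Mg E A Pi : ℝ≥0) {c₁ cΔ : ℝ}
    (hc₁ : 0 ≤ c₁) (hcΔ : 0 ≤ cΔ) :
    ∃ a : ℝ → ℝ, (∀ τ, 0 ≤ a τ) ∧ Monotone a ∧ Tendsto a (𝓝[>] 0) (𝓝 0) ∧
      ∀ (T : ℝ) (u₀ : EuclideanSpace ℝ (Fin 3) → EuclideanSpace ℝ (Fin 3))
        (u : ℝ → EuclideanSpace ℝ (Fin 3) → EuclideanSpace ℝ (Fin 3)) (p : ℝ → EuclideanSpace ℝ (Fin 3) → ℝ)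
        (G : ℝ → EuclideanSpace ℝ (Fin 3) → EuclideanSpace ℝ (Fin 3) →L[ℝ] EuclideanSpace ℝ (Fin 3))
        (e : ℝ → EuclideanSpace ℝ (Fin 3) → EuclideanSpace ℝ (Fin 3))
        (x₀ : EuclideanSpace ℝ (Fin 3)),
        IsLocalLeraySolutionOn T 1 u₀ u p →
        HasWeakSpatialGradientOn (slab (EuclideanSpace ℝ (Fin 3)) (Ioo 0 T) isOpen_Ioo) u G →
        (∀ᵐ t ∂(volume.restrict (Ioo 0 T)), ∫⁻ x in ball x₀ 3, ‖u t x‖ₑ ^ 2 ≤ E) →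
        (∫⁻ z in Ioo 0 T ×ˢ ball x₀ 3, ENNReal.ofReal (frobeniusNormSq (G z.1 z.2)) ≤ A) →
        (∫⁻ z in Ioo 0 T ×ˢ ball x₀ 3, ‖p z.1 z.2‖ₑ ^ (3 / 2 : ℝ) ≤ Pi) →
        IsSmoothSpaceTimeOn (Ioi 0) e →
        (∀ t, 0 < t → t ≤ 1 → eLpNorm (e t) 3 (volume.restrict (ball x₀ 3)) ≤ M) →
        (∀ t, 0 < t → t ≤ 1 →
          eLpNorm (e t) 6 (volume.restrict (ball x₀ 3)) ≤ (M₆ : ℝ≥0∞) * ENNReal.ofReal (t ^ (-(1 / 4 : ℝ)))) →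
        (∀ t, 0 < t → t ≤ 1 →
          eLpNorm (fderiv ℝ (e t)) 3 (volume.restrict (ball x₀ 3)) ≤ (Mg : ℝ≥0∞) * ENNReal.ofReal (t ^ (-(1 / 2 : ℝ)))) →
        ∀ τ : ℝ, 0 < τ → τ ≤ 1 → τ ≤ T →
          IntegrableOn (fun z : ℝ × EuclideanSpace ℝ (Fin 3) =>
            (cΔ * ‖u z.1 z.2 - e z.1 z.2‖ ^ 2 +
              2 * c₁ * ((‖u z.1 z.2 - e z.1 z.2‖ ^ 2 + ‖e z.1 z.2‖ ^ 2) *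
                ‖u z.1 z.2‖) +
              4 * c₁ * (|p z.1 z.2| * ‖u z.1 z.2 - e z.1 z.2‖) +
              2 * (‖fderiv ℝ (e z.1) z.2‖ * ‖e z.1 z.2‖ *
                ‖u z.1 z.2 - e z.1 z.2‖) +
              2 * c₁ * (‖e z.1 z.2‖ ^ 2 * ‖u z.1 z.2 - e z.1 z.2‖) +
              2 * c₁ * ‖e z.1 z.2‖ ^ 3 +
              4 * c₁ * (‖e z.1 z.2‖ * ‖u z.1 z.2 - e z.1 z.2‖ ^ 2) +
              c₁ ^ 2 * ‖u z.1 z.2 - e z.1 z.2‖ ^ 2)) (Ioo 0 τ ×ˢ ball x₀ 3) volume ∧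
          ∫ z in Ioo 0 τ ×ˢ ball x₀ 3,
            (cΔ * ‖u z.1 z.2 - e z.1 z.2‖ ^ 2 +
              2 * c₁ * ((‖u z.1 z.2 - e z.1 z.2‖ ^ 2 + ‖e z.1 z.2‖ ^ 2) *
                ‖u z.1 z.2‖) +
              4 * c₁ * (|p z.1 z.2| * ‖u z.1 z.2 - e z.1 z.2‖) +
              2 * (‖fderiv ℝ (e z.1) z.2‖ * ‖e z.1 z.2‖ *
                ‖u z.1 z.2 - e z.1 z.2‖) +
              2 * c₁ * (‖e z.1 z.2‖ ^ 2 * ‖u z.1 z.2 - e z.1 z.2‖) +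
              2 * c₁ * ‖e z.1 z.2‖ ^ 3 +
              4 * c₁ * (‖e z.1 z.2‖ * ‖u z.1 z.2 - e z.1 z.2‖ ^ 2) +
              c₁ ^ 2 * ‖u z.1 z.2 - e z.1 z.2‖ ^ 2) ≤ a τ := by
  -- ### constants
  obtain ⟨Kc, hKc⟩ := exists_lintegral_cube_box_le_explicit (3 : ℝ)
  set V : ℝ≥0∞ := volume (ball (0 : EuclideanSpace ℝ (Fin 3)) 3) with hV
  have hVfin : V ≠ ∞ := measure_ball_lt_top.ne
  -- real parameters
  set Mr : ℝ := (M : ℝ) with hMr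
  set Er : ℝ := (E : ℝ) with hEr
  set Ar : ℝ := (A : ℝ) with hAr
  set Pr : ℝ := (Pi : ℝ) with hPr
  set V3 : ℝ := V.toReal ^ (1 / 3 : ℝ) with hV3
  set Φr : ℝ → ℝ := fun s => (Kc : ℝ) * Er ^ (1 / 2 : ℝ) * ((Er * s) ^ (1 / 4 : ℝ) * (Er * s + Ar) ^ (3 / 4 : ℝ)) with hΦr
  set Wb : ℝ := (2 * Er + 2 * (Mr ^ 2 * V3)) ^ (1 / 2 : ℝ) with hWb
  set CDr : ℝ := (Mg : ℝ) * (M₆ : ℝ) * Wb with hCDr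
  set a : ℝ → ℝ := fun τ =>
    (cΔ + c₁ ^ 2) * (2 * (Er * max τ 0) + 2 * (Mr ^ 2 * V3 * max τ 0)) +
      2 * c₁ * (3 * Φr (max τ 0) + 2 * (Mr ^ 3 * max τ 0)) +
      8 * c₁ * (Φr (max τ 0) + 2 * (Mr ^ 3 * max τ 0)) +
      2 * c₁ * (Φr (max τ 0) + 2 * (Mr ^ 3 * max τ 0)) + 2 * c₁ * (Mr ^ 3 * max τ 0) +
      4 * c₁ * (Pr ^ (2 / 3 : ℝ) * (4 * Φr (max τ 0) + 4 * (Mr ^ 3 * max τ 0)) ^ (1 / 3 : ℝ)) +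
      2 * (CDr * (4 * (max τ 0) ^ (1 / 4 : ℝ))) with ha
  have hMr0 : 0 ≤ Mr := M.coe_nonneg
  have hEr0 : 0 ≤ Er := E.coe_nonneg
  have hAr0 : 0 ≤ Ar := A.coe_nonneg
  have hPr0 : 0 ≤ Pr := Pi.coe_nonneg
  have hV30 : 0 ≤ V3 := Real.rpow_nonneg ENNReal.toReal_nonneg _
  have hΦ0 : ∀ s, 0 ≤ s → 0 ≤ Φr s := fun s hs => by
    simp only [hΦr]
    exact mul_nonneg (mul_nonneg (Kc.coe_nonneg) (Real.rpow_nonneg hEr0 _))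
      (mul_nonneg (Real.rpow_nonneg (mul_nonneg hEr0 hs) _) (Real.rpow_nonneg (by positivity) _))
  have hWb0 : 0 ≤ Wb := Real.rpow_nonneg (by positivity) _
  have hCDr0 : 0 ≤ CDr := by simp only [hCDr]; positivity
  have ha0 : ∀ τ, 0 ≤ a τ := by
    intro τ
    have hs : 0 ≤ max τ 0 := le_max_right _ _
    have h1 := hΦ0 _ hs
    simp only [ha]
    have h2 : 0 ≤ Pr ^ (2 / 3 : ℝ) * (4 * Φr (max τ 0) + 4 * (Mr ^ 3 * max τ 0)) ^ (1 / 3 : ℝ) :=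
      mul_nonneg (Real.rpow_nonneg hPr0 _) (Real.rpow_nonneg (by positivity) _)
    have h3 : 0 ≤ CDr * (4 * (max τ 0) ^ (1 / 4 : ℝ)) := mul_nonneg hCDr0 (by positivity)
    positivity
  -- ### `a(τ) → 0`
  have hcont : Continuous a := by
    have hm : Continuous fun τ : ℝ => max τ 0 := continuous_id.max continuous_const
    have hΦc : Continuous fun τ : ℝ => Φr (max τ 0) := by
      simp only [hΦr]
      refine continuous_const.mul ((Real.continuous_rpow_const (by norm_num)).comp (continuous_const.mul hm)
        |>.mul ((Real.continuous_rpow_const (by norm_num)).comp ((continuous_const.mul hm).add continuous_const)))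
    simp only [ha]
    have h4 : Continuous fun τ : ℝ => (max τ 0) ^ (1 / 4 : ℝ) := (Real.continuous_rpow_const (by norm_num)).comp hm
    have h5 : Continuous fun τ : ℝ => (4 * Φr (max τ 0) + 4 * (Mr ^ 3 * max τ 0)) ^ (1 / 3 : ℝ) :=
      (Real.continuous_rpow_const (by norm_num)).comp ((continuous_const.mul hΦc).add (continuous_const.mul
        (continuous_const.mul hm)))
    refine ((((((continuous_const.mul ((continuous_const.mul (continuous_const.mul hm)).add
      (continuous_const.mul ((continuous_const.mul hm))))).add
      (continuous_const.mul ((continuous_const.mul hΦc).add (continuous_const.mul (continuous_const.mul hm))))).add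
      (continuous_const.mul (hΦc.add (continuous_const.mul (continuous_const.mul hm))))).add
      (continuous_const.mul (hΦc.add (continuous_const.mul (continuous_const.mul hm))))).add
      (continuous_const.mul (continuous_const.mul hm))).add
      (continuous_const.mul (continuous_const.mul h5))).add (continuous_const.mul (continuous_const.mul
        (continuous_const.mul h4)))
  have ha_zero : a 0 = 0 := by
    have hΦ00 : Φr 0 = 0 := by
      simp only [hΦr, mul_zero, Real.zero_rpow (by norm_num : (1 / 4 : ℝ) ≠ 0), zero_mul, mul_zero]
    simp only [ha, max_self, hΦ00, mul_zero, add_zero,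
      Real.zero_rpow (by norm_num : (1 / 3 : ℝ) ≠ 0), Real.zero_rpow (by norm_num : (1 / 4 : ℝ) ≠ 0)]
  have hlim : Tendsto a (𝓝[>] 0) (𝓝 0) := by
    have := hcont.tendsto 0
    rw [ha_zero] at this
    exact this.mono_left nhdsWithin_le_nhds
  have hmono : Monotone a := by
    intro τ₁ τ₂ hle
    have hs : max τ₁ 0 ≤ max τ₂ 0 := max_le_max hle le_rfl
    have hs0 : 0 ≤ max τ₁ 0 := le_max_right _ _
    have hΦm : Φr (max τ₁ 0) ≤ Φr (max τ₂ 0) := by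
      simp only [hΦr]
      gcongr
    have hΦ1 := hΦ0 _ hs0
    simp only [ha]
    gcongr
  refine ⟨a, ha0, hmono, hlim, ?_⟩
  -- ### the data
  intro T u₀ u p G e x₀ h hG hE hA hP hsm hM3' he6 hDe3 τ hτ hτ1 hτT
  set B : Set (EuclideanSpace ℝ (Fin 3)) := ball x₀ 3 with hBdef
  have hBm : MeasurableSet B := measurableSet_ball
  set C : Set (ℝ × EuclideanSpace ℝ (Fin 3)) := Ioo 0 τ ×ˢ B with hCdef
  have hCm : MeasurableSet C := measurableSet_Ioo.prod hBm
  have hCT : C ⊆ Ioo 0 T ×ˢ B := Set.prod_mono (Ioo_subset_Ioo le_rfl hτT) Subset.rfl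
  have hvolB : volume B = V := by rw [hBdef, hV]; exact Measure.addHaar_ball_center volume x₀ 3
  have hvolI : volume (Ioo (0 : ℝ) τ) = ENNReal.ofReal τ := by rw [Real.volume_Ioo, sub_zero]
  -- Tonelli in inequality form on the cylinder
  have μC : (volume : Measure (ℝ × EuclideanSpace ℝ (Fin 3))).restrict C =
      ((volume : Measure ℝ).restrict (Ioo 0 τ)).prod ((volume : Measure (EuclideanSpace ℝ (Fin 3))).restrict B) := by
    rw [Measure.prod_restrict, ← Measure.volume_eq_prod]
  have tonelli : ∀ f : ℝ × EuclideanSpace ℝ (Fin 3) → ℝ≥0∞,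
      ∫⁻ z in C, f z ≤ ∫⁻ t in Ioo 0 τ, ∫⁻ x in B, f (t, x) := fun f => by
    rw [μC]; exact lintegral_prod_le f
  -- ### the caloric field: continuity and the local `L³` bound in `lintegral` form
  have he_cont : ∀ t, 0 < t → Continuous (e t) := fun t ht => (hsm.contDiff_slice (S := Ioi 0) ht).continuous
  have hDe_cont : ∀ t, 0 < t → Continuous (fderiv ℝ (e t)) := fun t ht =>
    (hsm.contDiff_slice (S := Ioi 0) ht).continuous_fderiv (by simp)
  have hM3 : ∀ t, 0 < t → t ≤ 1 → ∫⁻ x in B, ‖e t x‖ₑ ^ 3 ≤ (M : ℝ≥0∞) ^ 3 := by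
    intro t ht ht1
    have h1 : eLpNorm (e t) 3 (volume.restrict B) = (∫⁻ x in B, ‖e t x‖ₑ ^ 3) ^ (1 / 3 : ℝ) := by
      rw [eLpNorm_eq_lintegral_rpow_enorm_toReal (by norm_num) (by norm_num)]
      simp only [ENNReal.toReal_ofNat, ENNReal.rpow_ofNat]
    have h2 : (∫⁻ x in B, ‖e t x‖ₑ ^ 3) = eLpNorm (e t) 3 (volume.restrict B) ^ 3 := by
      rw [h1, ← ENNReal.rpow_natCast _ 3, ← ENNReal.rpow_mul]; norm_num
    rw [h2]
    exact pow_le_pow_left' (hM3' t ht ht1) 3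
  -- ### the basic cylinder quantities
  have hEτ : ∀ᵐ t ∂(volume.restrict (Ioo 0 τ)), ∫⁻ x in B, ‖u t x‖ₑ ^ 2 ≤ E :=
    ae_restrict_of_ae_restrict_of_subset (Ioo_subset_Ioo le_rfl hτT) hE
  have Lu2 : ∫⁻ z in C, ‖u z.1 z.2‖ₑ ^ 2 ≤ E * ENNReal.ofReal τ := by
    refine (tonelli fun z => ‖u z.1 z.2‖ₑ ^ 2).trans ?_
    calc ∫⁻ t in Ioo 0 τ, ∫⁻ x in B, ‖u t x‖ₑ ^ 2 ≤ ∫⁻ _ in Ioo 0 τ, (E : ℝ≥0∞) := lintegral_mono_ae hEτ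
      _ = E * ENNReal.ofReal τ := by rw [setLIntegral_const, hvolI]
  have Le3 : ∫⁻ z in C, ‖e z.1 z.2‖ₑ ^ 3 ≤ (M : ℝ≥0∞) ^ 3 * ENNReal.ofReal τ := by
    refine (tonelli fun z => ‖e z.1 z.2‖ₑ ^ 3).trans ?_
    calc ∫⁻ t in Ioo 0 τ, ∫⁻ x in B, ‖e t x‖ₑ ^ 3 ≤ ∫⁻ _ in Ioo 0 τ, (M : ℝ≥0∞) ^ 3 := by
          refine lintegral_mono_ae ((ae_restrict_iff' measurableSet_Ioo).2 (Eventually.of_forall fun t ht => ?_))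
          exact hM3 t ht.1 (ht.2.le.trans hτ1)
      _ = (M : ℝ≥0∞) ^ 3 * ENNReal.ofReal τ := by rw [setLIntegral_const, hvolI]
  have hM2V : ∀ t, 0 < t → t ≤ 1 → ∫⁻ x in B, ‖e t x‖ₑ ^ 2 ≤ (M : ℝ≥0∞) ^ 2 * V ^ (1 / 3 : ℝ) := by
    intro t ht ht1
    have h1 := lintegral_enorm_sq_le_cube_rpow (μ := volume.restrict B) (he_cont t ht).aestronglyMeasurable
    rw [Measure.restrict_apply_univ, hvolB] at h1
    refine h1.trans ?_
    have h2 : (∫⁻ x in B, ‖e t x‖ₑ ^ 3) ^ (2 / 3 : ℝ) ≤ ((M : ℝ≥0∞) ^ 3) ^ (2 / 3 : ℝ) :=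
      ENNReal.rpow_le_rpow (hM3 t ht ht1) (by norm_num)
    have h3 : ((M : ℝ≥0∞) ^ 3) ^ (2 / 3 : ℝ) = (M : ℝ≥0∞) ^ 2 := by
      rw [← ENNReal.rpow_natCast _ 3, ← ENNReal.rpow_mul, ← ENNReal.rpow_natCast _ 2]; norm_num
    rw [h3] at h2
    exact mul_le_mul' h2 le_rfl
  have Le2 : ∫⁻ z in C, ‖e z.1 z.2‖ₑ ^ 2 ≤ (M : ℝ≥0∞) ^ 2 * V ^ (1 / 3 : ℝ) * ENNReal.ofReal τ := by
    refine (tonelli fun z => ‖e z.1 z.2‖ₑ ^ 2).trans ?_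
    calc ∫⁻ t in Ioo 0 τ, ∫⁻ x in B, ‖e t x‖ₑ ^ 2 ≤ ∫⁻ _ in Ioo 0 τ, (M : ℝ≥0∞) ^ 2 * V ^ (1 / 3 : ℝ) :=
          lintegral_mono_ae ((ae_restrict_iff' measurableSet_Ioo).2 (Eventually.of_forall fun t ht =>
            hM2V t ht.1 (ht.2.le.trans hτ1)))
      _ = (M : ℝ≥0∞) ^ 2 * V ^ (1 / 3 : ℝ) * ENNReal.ofReal τ := by rw [setLIntegral_const, hvolI]
  have hAτ : ∫⁻ z in C, ENNReal.ofReal (frobeniusNormSq (G z.1 z.2)) ≤ A := (lintegral_mono_set hCT).trans hA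
  set Φ : ℝ≥0∞ := Kc * (E : ℝ≥0∞) ^ (1 / 2 : ℝ) * (((E : ℝ≥0∞) * ENNReal.ofReal τ) ^ (1 / 4 : ℝ) *
    ((E : ℝ≥0∞) * ENNReal.ofReal τ + A) ^ (3 / 4 : ℝ)) with hΦ
  have Lu3 : ∫⁻ z in C, ‖u z.1 z.2‖ₑ ^ 3 ≤ Φ := by
    have h1 := hKc τ u G x₀ E A ENNReal.coe_ne_top (hG.mono (slab_mono (Ioo_subset_Ioo le_rfl hτT))) hEτ hAτ
    rw [hvolI] at h1
    exact h1
  have Lp : ∫⁻ z in C, ‖p z.1 z.2‖ₑ ^ (3 / 2 : ℝ) ≤ Pi := (lintegral_mono_set hCT).trans hP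
  -- measurability on `C`
  have hum : AEStronglyMeasurable (fun z : ℝ × EuclideanSpace ℝ (Fin 3) => u z.1 z.2) (volume.restrict C) :=
    h.aestronglyMeasurable.mono_measure (Measure.restrict_mono (hCT.trans (Set.prod_mono Subset.rfl (subset_univ _))) le_rfl)
  have hCIoi : C ⊆ Ioi (0 : ℝ) ×ˢ (univ : Set (EuclideanSpace ℝ (Fin 3))) := fun z hz => ⟨hz.1.1, mem_univ _⟩
  have hem : AEStronglyMeasurable (fun z : ℝ × EuclideanSpace ℝ (Fin 3) => e z.1 z.2) (volume.restrict C) :=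
    ((ContDiffOn.continuousOn hsm).aestronglyMeasurable (measurableSet_Ioi.prod MeasurableSet.univ)).mono_measure
      (Measure.restrict_mono hCIoi le_rfl)
  have Lw2 : ∫⁻ z in C, ‖u z.1 z.2 - e z.1 z.2‖ₑ ^ 2 ≤
      2 * ((E : ℝ≥0∞) * ENNReal.ofReal τ) + 2 * ((M : ℝ≥0∞) ^ 2 * V ^ (1 / 3 : ℝ) * ENNReal.ofReal τ) := by
    calc ∫⁻ z in C, ‖u z.1 z.2 - e z.1 z.2‖ₑ ^ 2 ≤ ∫⁻ z in C, (2 * ‖u z.1 z.2‖ₑ ^ 2 + 2 * ‖e z.1 z.2‖ₑ ^ 2) :=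
          lintegral_mono fun z => enorm_sub_sq_le _ _
      _ = (2 * ∫⁻ z in C, ‖u z.1 z.2‖ₑ ^ 2) + 2 * ∫⁻ z in C, ‖e z.1 z.2‖ₑ ^ 2 := by
          rw [lintegral_add_left' ((hum.aemeasurable.enorm.pow_const _).const_mul _),
            lintegral_const_mul'' _ (hum.aemeasurable.enorm.pow_const _),
            lintegral_const_mul'' _ (hem.aemeasurable.enorm.pow_const _)]
      _ ≤ _ := add_le_add (mul_le_mul' le_rfl Lu2) (mul_le_mul' le_rfl Le2)
  have Lw3 : ∫⁻ z in C, ‖u z.1 z.2 - e z.1 z.2‖ₑ ^ 3 ≤ 4 * Φ + 4 * ((M : ℝ≥0∞) ^ 3 * ENNReal.ofReal τ) := by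
    calc ∫⁻ z in C, ‖u z.1 z.2 - e z.1 z.2‖ₑ ^ 3 ≤ ∫⁻ z in C, (4 * ‖u z.1 z.2‖ₑ ^ 3 + 4 * ‖e z.1 z.2‖ₑ ^ 3) :=
          lintegral_mono fun z => enorm_sub_pow_three_le _ _
      _ = (4 * ∫⁻ z in C, ‖u z.1 z.2‖ₑ ^ 3) + 4 * ∫⁻ z in C, ‖e z.1 z.2‖ₑ ^ 3 := by
          rw [lintegral_add_left' ((hum.aemeasurable.enorm.pow_const _).const_mul _),
            lintegral_const_mul'' _ (hum.aemeasurable.enorm.pow_const _),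
            lintegral_const_mul'' _ (hem.aemeasurable.enorm.pow_const _)]
      _ ≤ _ := add_le_add (mul_le_mul' le_rfl Lu3) (mul_le_mul' le_rfl Le3)
  -- ### the term with `De`: slice-wise Hölder `(2, 3, 6)` and `∫₀^τ t^{-3/4} = 4 τ^{1/4}`
  have hslice := ae_slice_aestronglyMeasurable_and_lintegral_ball_lt_top h.aestronglyMeasurable
    (fun K' hK' => h.sqIntegrable K' hK')
  set Wb' : ℝ≥0∞ := (2 * (E : ℝ≥0∞) + 2 * ((M : ℝ≥0∞) ^ 2 * V ^ (1 / 3 : ℝ))) ^ (1 / 2 : ℝ) with hWb'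
  set KD : ℝ≥0∞ := Wb' * (Mg : ℝ≥0∞) * (M₆ : ℝ≥0∞) with hKD
  have hinner : ∀ᵐ t ∂(volume.restrict (Ioo 0 τ)),
      ∫⁻ x in B, ‖fderiv ℝ (e t) x‖ₑ * ‖e t x‖ₑ * ‖u t x - e t x‖ₑ ≤ KD * ENNReal.ofReal (t ^ (-(3 / 4 : ℝ))) := by
    have hsl := ae_restrict_of_ae_restrict_of_subset (Ioo_subset_Ioo le_rfl hτT) hslice
    filter_upwards [hEτ, hsl, ae_restrict_mem measurableSet_Ioo] with t hEt hst htI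
    have ht : 0 < t := htI.1
    have ht1 : t ≤ 1 := htI.2.le.trans hτ1
    obtain ⟨hut_m, -⟩ := hst
    have hwm : AEMeasurable (fun x => ‖u t x - e t x‖ₑ) (volume.restrict B) :=
      (hut_m.sub (he_cont t ht).aestronglyMeasurable).aemeasurable.enorm.restrict
    have hDm : AEMeasurable (fun x => ‖fderiv ℝ (e t) x‖ₑ) (volume.restrict B) :=
      (hDe_cont t ht).aestronglyMeasurable.aemeasurable.enorm.restrict
    have hem' : AEMeasurable (fun x => ‖e t x‖ₑ) (volume.restrict B) :=
      (he_cont t ht).aestronglyMeasurable.aemeasurable.enorm.restrict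
    have hH := lintegral_mul_mul_le_L2_L3_L6 (μ := volume.restrict B) hwm hDm hem'
    have e1 : ∫⁻ x in B, ‖fderiv ℝ (e t) x‖ₑ * ‖e t x‖ₑ * ‖u t x - e t x‖ₑ =
        ∫⁻ x in B, ‖u t x - e t x‖ₑ * ‖fderiv ℝ (e t) x‖ₑ * ‖e t x‖ₑ := lintegral_congr fun x => by ring
    rw [e1]
    refine hH.trans ?_
    -- the three factors
    have f1 : (∫⁻ x in B, ‖u t x - e t x‖ₑ ^ 2) ^ (1 / 2 : ℝ) ≤ Wb' := by
      refine ENNReal.rpow_le_rpow ?_ (by norm_num)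
      calc ∫⁻ x in B, ‖u t x - e t x‖ₑ ^ 2 ≤ ∫⁻ x in B, (2 * ‖u t x‖ₑ ^ 2 + 2 * ‖e t x‖ₑ ^ 2) :=
            lintegral_mono fun x => enorm_sub_sq_le _ _
        _ = (2 * ∫⁻ x in B, ‖u t x‖ₑ ^ 2) + 2 * ∫⁻ x in B, ‖e t x‖ₑ ^ 2 := by
            rw [lintegral_add_left' ((hut_m.aemeasurable.enorm.pow_const _).restrict.const_mul _),
              lintegral_const_mul'' _ (hut_m.aemeasurable.enorm.pow_const _).restrict,
              lintegral_const_mul'' _ (hem'.pow_const _)]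
        _ ≤ 2 * (E : ℝ≥0∞) + 2 * ((M : ℝ≥0∞) ^ 2 * V ^ (1 / 3 : ℝ)) :=
            add_le_add (mul_le_mul' le_rfl hEt) (mul_le_mul' le_rfl (hM2V t ht ht1))
    have f2 : (∫⁻ x in B, ‖fderiv ℝ (e t) x‖ₑ ^ 3) ^ (1 / 3 : ℝ) ≤ (Mg : ℝ≥0∞) * ENNReal.ofReal (t ^ (-(1 / 2 : ℝ))) := by
      have h1 : (∫⁻ x in B, ‖fderiv ℝ (e t) x‖ₑ ^ 3) ^ (1 / 3 : ℝ) ≤ eLpNorm (fderiv ℝ (e t)) 3 (volume.restrict B) := by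
        rw [eLpNorm_eq_lintegral_rpow_enorm_toReal (by norm_num) (by norm_num)]
        simp only [ENNReal.toReal_ofNat, ENNReal.rpow_ofNat]
        exact ENNReal.rpow_le_rpow le_rfl (by norm_num)
      exact h1.trans (hDe3 t ht ht1)
    have f3 : (∫⁻ x in B, ‖e t x‖ₑ ^ 6) ^ (1 / 6 : ℝ) ≤ (M₆ : ℝ≥0∞) * ENNReal.ofReal (t ^ (-(1 / 4 : ℝ))) := by
      have h1 : (∫⁻ x in B, ‖e t x‖ₑ ^ 6) ^ (1 / 6 : ℝ) ≤ eLpNorm (e t) 6 (volume.restrict B) := by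
        rw [eLpNorm_eq_lintegral_rpow_enorm_toReal (by norm_num) (by norm_num)]
        simp only [ENNReal.toReal_ofNat, ENNReal.rpow_ofNat]
        exact ENNReal.rpow_le_rpow le_rfl (by norm_num)
      exact h1.trans (he6 t ht ht1)
    calc (∫⁻ x in B, ‖u t x - e t x‖ₑ ^ 2) ^ (1 / 2 : ℝ) * (∫⁻ x in B, ‖fderiv ℝ (e t) x‖ₑ ^ 3) ^ (1 / 3 : ℝ) *
          (∫⁻ x in B, ‖e t x‖ₑ ^ 6) ^ (1 / 6 : ℝ)
        ≤ Wb' * ((Mg : ℝ≥0∞) * ENNReal.ofReal (t ^ (-(1 / 2 : ℝ)))) *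
          ((M₆ : ℝ≥0∞) * ENNReal.ofReal (t ^ (-(1 / 4 : ℝ)))) := mul_le_mul' (mul_le_mul' f1 f2) f3
      _ = KD * (ENNReal.ofReal (t ^ (-(1 / 2 : ℝ))) * ENNReal.ofReal (t ^ (-(1 / 4 : ℝ)))) := by
          rw [hKD]; ring
      _ = KD * ENNReal.ofReal (t ^ (-(3 / 4 : ℝ))) := by
          rw [← ENNReal.ofReal_mul (Real.rpow_nonneg ht.le _), ← Real.rpow_add ht]; norm_num
  have LDe : ∫⁻ z in C, ‖fderiv ℝ (e z.1) z.2‖ₑ * ‖e z.1 z.2‖ₑ * ‖u z.1 z.2 - e z.1 z.2‖ₑ ≤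
      KD * ENNReal.ofReal (4 * τ ^ (1 / 4 : ℝ)) := by
    refine (tonelli fun z => ‖fderiv ℝ (e z.1) z.2‖ₑ * ‖e z.1 z.2‖ₑ * ‖u z.1 z.2 - e z.1 z.2‖ₑ).trans ?_
    calc ∫⁻ t in Ioo 0 τ, ∫⁻ x in B, ‖fderiv ℝ (e t) x‖ₑ * ‖e t x‖ₑ * ‖u t x - e t x‖ₑ
        ≤ ∫⁻ t in Ioo 0 τ, KD * ENNReal.ofReal (t ^ (-(3 / 4 : ℝ))) := lintegral_mono_ae hinner
      _ = KD * ENNReal.ofReal (4 * τ ^ (1 / 4 : ℝ)) := by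
          rw [lintegral_const_mul' _ _ ?_, lintegral_Ioo_rpow_neg_three_quarters' hτ.le]
          simp only [hKD, hWb']
          refine ENNReal.mul_ne_top (ENNReal.mul_ne_top ?_ ENNReal.coe_ne_top) ENNReal.coe_ne_top
          refine ENNReal.rpow_ne_top_of_nonneg (by norm_num) (ENNReal.add_ne_top.2 ⟨?_, ?_⟩)
          · exact ENNReal.mul_ne_top (by simp) ENNReal.coe_ne_top
          · exact ENNReal.mul_ne_top (by simp) (ENNReal.mul_ne_top (by simp)
              (ENNReal.rpow_ne_top_of_nonneg (by norm_num) hVfin))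
  -- ### measurability of the remaining fields on `C`
  have hDcont := (hsm.fderiv_slice (uniqueDiffOn_Ioi 0)).continuousOn
  have hDem : AEStronglyMeasurable (fun z : ℝ × EuclideanSpace ℝ (Fin 3) => fderiv ℝ (e z.1) z.2) (volume.restrict C) :=
    (hDcont.aestronglyMeasurable (measurableSet_Ioi.prod MeasurableSet.univ)).mono_measure
      (Measure.restrict_mono hCIoi le_rfl)
  have hCcl : C ⊆ Ioo 0 T ×ˢ closedBall x₀ 3 := hCT.trans (Set.prod_mono Subset.rfl ball_subset_closedBall)
  have hpm : AEStronglyMeasurable (fun z : ℝ × EuclideanSpace ℝ (Fin 3) => p z.1 z.2) (volume.restrict C) :=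
    (h.integrableOn_pressure (isCompact_closedBall x₀ 3)).aestronglyMeasurable.mono_measure
      (Measure.restrict_mono hCcl le_rfl)
  have hwm : AEStronglyMeasurable (fun z : ℝ × EuclideanSpace ℝ (Fin 3) => u z.1 z.2 - e z.1 z.2) (volume.restrict C) :=
    hum.sub hem
  -- ### the eight pieces as `ℝ≥0∞`-valued functions and their integrals
  have hu3m : AEMeasurable (fun z : ℝ × EuclideanSpace ℝ (Fin 3) => ‖u z.1 z.2‖ₑ ^ 3) (volume.restrict C) :=
    hum.aemeasurable.enorm.pow_const _
  have he3m : AEMeasurable (fun z : ℝ × EuclideanSpace ℝ (Fin 3) => ‖e z.1 z.2‖ₑ ^ 3) (volume.restrict C) :=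
    hem.aemeasurable.enorm.pow_const _
  set τ' : ℝ≥0∞ := ENNReal.ofReal τ with hτ'
  set M3 : ℝ≥0∞ := (M : ℝ≥0∞) ^ 3 * τ' with hM3def
  set W2 : ℝ≥0∞ := 2 * ((E : ℝ≥0∞) * τ') + 2 * ((M : ℝ≥0∞) ^ 2 * V ^ (1 / 3 : ℝ) * τ') with hW2
  -- pointwise real inequalities (Young)
  have yng1 : ∀ a b : ℝ, 0 ≤ a → 0 ≤ b → b ^ 2 * a ≤ (2 * b ^ 3 + a ^ 3) / 3 := fun a b ha hb => by
    nlinarith [sq_nonneg (a - b), mul_nonneg (mul_nonneg hb hb) ha, mul_nonneg ha hb,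
      mul_nonneg (sq_nonneg (a - b)) (add_nonneg (mul_nonneg two_pos.le hb) ha)]
  have pw2 : ∀ z : ℝ × EuclideanSpace ℝ (Fin 3),
      (‖u z.1 z.2 - e z.1 z.2‖ ^ 2 + ‖e z.1 z.2‖ ^ 2) * ‖u z.1 z.2‖ ≤ 3 * ‖u z.1 z.2‖ ^ 3 + 2 * ‖e z.1 z.2‖ ^ 3 := by
    intro z
    set a := ‖u z.1 z.2‖; set b := ‖e z.1 z.2‖
    have ha : 0 ≤ a := norm_nonneg _
    have hb : 0 ≤ b := norm_nonneg _
    have hw : ‖u z.1 z.2 - e z.1 z.2‖ ^ 2 ≤ 2 * a ^ 2 + 2 * b ^ 2 := by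
      nlinarith [norm_sub_le (u z.1 z.2) (e z.1 z.2), sq_nonneg (a - b), norm_nonneg (u z.1 z.2 - e z.1 z.2)]
    have h1 := yng1 a b ha hb
    nlinarith [mul_le_mul_of_nonneg_right hw ha, h1, pow_nonneg ha 3, pow_nonneg hb 3]
  have pw5 : ∀ z : ℝ × EuclideanSpace ℝ (Fin 3),
      ‖e z.1 z.2‖ ^ 2 * ‖u z.1 z.2 - e z.1 z.2‖ ≤ ‖u z.1 z.2‖ ^ 3 + 2 * ‖e z.1 z.2‖ ^ 3 := by
    intro z
    set a := ‖u z.1 z.2‖; set b := ‖e z.1 z.2‖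
    have ha : 0 ≤ a := norm_nonneg _
    have hb : 0 ≤ b := norm_nonneg _
    have hw : ‖u z.1 z.2 - e z.1 z.2‖ ≤ a + b := norm_sub_le _ _
    have h1 := yng1 a b ha hb
    nlinarith [mul_le_mul_of_nonneg_left hw (sq_nonneg b), pow_nonneg ha 3, pow_nonneg hb 3]
  have pw7 : ∀ z : ℝ × EuclideanSpace ℝ (Fin 3),
      ‖e z.1 z.2‖ * ‖u z.1 z.2 - e z.1 z.2‖ ^ 2 ≤ 2 * ‖u z.1 z.2‖ ^ 3 + 4 * ‖e z.1 z.2‖ ^ 3 := by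
    intro z
    set a := ‖u z.1 z.2‖; set b := ‖e z.1 z.2‖
    have ha : 0 ≤ a := norm_nonneg _
    have hb : 0 ≤ b := norm_nonneg _
    have hw : ‖u z.1 z.2 - e z.1 z.2‖ ^ 2 ≤ 2 * a ^ 2 + 2 * b ^ 2 := by
      nlinarith [norm_sub_le (u z.1 z.2) (e z.1 z.2), sq_nonneg (a - b), norm_nonneg (u z.1 z.2 - e z.1 z.2)]
    have h1 : a ^ 2 * b ≤ (2 * a ^ 3 + b ^ 3) / 3 := by
      nlinarith [sq_nonneg (a - b), mul_nonneg (mul_nonneg ha ha) hb, mul_nonneg ha hb,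
        mul_nonneg (sq_nonneg (a - b)) (add_nonneg (mul_nonneg two_pos.le ha) hb)]
    nlinarith [mul_le_mul_of_nonneg_left hw hb, h1, pow_nonneg ha 3, pow_nonneg hb 3]
  -- lintegrals of the pieces
  have I1 : ∫⁻ z in C, ‖u z.1 z.2 - e z.1 z.2‖ₑ ^ 2 ≤ W2 := Lw2
  have I2 : ∫⁻ z in C, ENNReal.ofReal ((‖u z.1 z.2 - e z.1 z.2‖ ^ 2 + ‖e z.1 z.2‖ ^ 2) * ‖u z.1 z.2‖) ≤ 3 * Φ + 2 * M3 := by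
    calc ∫⁻ z in C, ENNReal.ofReal ((‖u z.1 z.2 - e z.1 z.2‖ ^ 2 + ‖e z.1 z.2‖ ^ 2) * ‖u z.1 z.2‖)
        ≤ ∫⁻ z in C, (3 * ‖u z.1 z.2‖ₑ ^ 3 + 2 * ‖e z.1 z.2‖ₑ ^ 3) := by
          refine lintegral_mono fun z => ?_
          refine (ENNReal.ofReal_le_ofReal (pw2 z)).trans (le_of_eq ?_)
          rw [ENNReal.ofReal_add (by positivity) (by positivity), ENNReal.ofReal_mul (by norm_num),
            ENNReal.ofReal_mul (by norm_num), ENNReal.ofReal_pow (norm_nonneg _), ENNReal.ofReal_pow (norm_nonneg _),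
            ofReal_norm, ofReal_norm, ENNReal.ofReal_ofNat, ENNReal.ofReal_ofNat]
      _ = (3 * ∫⁻ z in C, ‖u z.1 z.2‖ₑ ^ 3) + 2 * ∫⁻ z in C, ‖e z.1 z.2‖ₑ ^ 3 := by
          rw [lintegral_add_left' (hu3m.const_mul _), lintegral_const_mul'' _ hu3m, lintegral_const_mul'' _ he3m]
      _ ≤ 3 * Φ + 2 * M3 := add_le_add (mul_le_mul' le_rfl Lu3) (mul_le_mul' le_rfl Le3)
  have I3 : ∫⁻ z in C, ‖p z.1 z.2‖ₑ * ‖u z.1 z.2 - e z.1 z.2‖ₑ ≤ (Pi : ℝ≥0∞) ^ (2 / 3 : ℝ) * (4 * Φ + 4 * M3) ^ (1 / 3 : ℝ) := by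
    have hH := lintegral_mul_le_L32_L3 (μ := volume.restrict C) hpm.aemeasurable.enorm hwm.aemeasurable.enorm
    refine hH.trans ?_
    exact mul_le_mul' (ENNReal.rpow_le_rpow Lp (by norm_num)) (ENNReal.rpow_le_rpow Lw3 (by norm_num))
  have I5 : ∫⁻ z in C, ENNReal.ofReal (‖e z.1 z.2‖ ^ 2 * ‖u z.1 z.2 - e z.1 z.2‖) ≤ Φ + 2 * M3 := by
    calc ∫⁻ z in C, ENNReal.ofReal (‖e z.1 z.2‖ ^ 2 * ‖u z.1 z.2 - e z.1 z.2‖)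
        ≤ ∫⁻ z in C, (‖u z.1 z.2‖ₑ ^ 3 + 2 * ‖e z.1 z.2‖ₑ ^ 3) := by
          refine lintegral_mono fun z => ?_
          refine (ENNReal.ofReal_le_ofReal (pw5 z)).trans (le_of_eq ?_)
          rw [ENNReal.ofReal_add (by positivity) (by positivity), ENNReal.ofReal_mul (by norm_num),
            ENNReal.ofReal_pow (norm_nonneg _), ENNReal.ofReal_pow (norm_nonneg _), ofReal_norm, ofReal_norm,
            ENNReal.ofReal_ofNat]
      _ = (∫⁻ z in C, ‖u z.1 z.2‖ₑ ^ 3) + 2 * ∫⁻ z in C, ‖e z.1 z.2‖ₑ ^ 3 := by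
          rw [lintegral_add_left' hu3m, lintegral_const_mul'' _ he3m]
      _ ≤ Φ + 2 * M3 := add_le_add Lu3 (mul_le_mul' le_rfl Le3)
  have I7 : ∫⁻ z in C, ENNReal.ofReal (‖e z.1 z.2‖ * ‖u z.1 z.2 - e z.1 z.2‖ ^ 2) ≤ 2 * Φ + 4 * M3 := by
    calc ∫⁻ z in C, ENNReal.ofReal (‖e z.1 z.2‖ * ‖u z.1 z.2 - e z.1 z.2‖ ^ 2)
        ≤ ∫⁻ z in C, (2 * ‖u z.1 z.2‖ₑ ^ 3 + 4 * ‖e z.1 z.2‖ₑ ^ 3) := by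
          refine lintegral_mono fun z => ?_
          refine (ENNReal.ofReal_le_ofReal (pw7 z)).trans (le_of_eq ?_)
          rw [ENNReal.ofReal_add (by positivity) (by positivity), ENNReal.ofReal_mul (by norm_num),
            ENNReal.ofReal_mul (by norm_num), ENNReal.ofReal_pow (norm_nonneg _), ENNReal.ofReal_pow (norm_nonneg _),
            ofReal_norm, ofReal_norm, ENNReal.ofReal_ofNat, ENNReal.ofReal_ofNat]
      _ = (2 * ∫⁻ z in C, ‖u z.1 z.2‖ₑ ^ 3) + 4 * ∫⁻ z in C, ‖e z.1 z.2‖ₑ ^ 3 := by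
          rw [lintegral_add_left' (hu3m.const_mul _), lintegral_const_mul'' _ hu3m, lintegral_const_mul'' _ he3m]
      _ ≤ 2 * Φ + 4 * M3 := add_le_add (mul_le_mul' le_rfl Lu3) (mul_le_mul' le_rfl Le3)
  -- ### finiteness and the real values of the bounds
  have hτ'fin : τ' ≠ ∞ := ENNReal.ofReal_ne_top
  have hM3fin : M3 ≠ ∞ := ENNReal.mul_ne_top (ENNReal.pow_ne_top ENNReal.coe_ne_top) hτ'fin
  have hV3fin : V ^ (1 / 3 : ℝ) ≠ ∞ := ENNReal.rpow_ne_top_of_nonneg (by norm_num) hVfin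
  have hW2fin : W2 ≠ ∞ := ENNReal.add_ne_top.2 ⟨ENNReal.mul_ne_top (by simp) (ENNReal.mul_ne_top ENNReal.coe_ne_top hτ'fin),
    ENNReal.mul_ne_top (by simp) (ENNReal.mul_ne_top (ENNReal.mul_ne_top (ENNReal.pow_ne_top ENNReal.coe_ne_top) hV3fin) hτ'fin)⟩
  have hEτfin : (E : ℝ≥0∞) * τ' ≠ ∞ := ENNReal.mul_ne_top ENNReal.coe_ne_top hτ'fin
  have hΦfin : Φ ≠ ∞ := by
    refine ENNReal.mul_ne_top (ENNReal.mul_ne_top ENNReal.coe_ne_top (ENNReal.rpow_ne_top_of_nonneg (by norm_num) ENNReal.coe_ne_top))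
      (ENNReal.mul_ne_top (ENNReal.rpow_ne_top_of_nonneg (by norm_num) hEτfin)
        (ENNReal.rpow_ne_top_of_nonneg (by norm_num) (ENNReal.add_ne_top.2 ⟨hEτfin, ENNReal.coe_ne_top⟩)))
  have hWb'fin : Wb' ≠ ∞ := ENNReal.rpow_ne_top_of_nonneg (by norm_num) (ENNReal.add_ne_top.2
    ⟨ENNReal.mul_ne_top (by simp) ENNReal.coe_ne_top,
     ENNReal.mul_ne_top (by simp) (ENNReal.mul_ne_top (ENNReal.pow_ne_top ENNReal.coe_ne_top) hV3fin)⟩)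
  have hKDfin : KD ≠ ∞ := ENNReal.mul_ne_top (ENNReal.mul_ne_top hWb'fin ENNReal.coe_ne_top) ENNReal.coe_ne_top
  -- real values
  have tτ : τ'.toReal = τ := ENNReal.toReal_ofReal hτ.le
  have tM : ((M : ℝ≥0∞)).toReal = Mr := ENNReal.coe_toReal M
  have tE : ((E : ℝ≥0∞)).toReal = Er := ENNReal.coe_toReal E
  have tA : ((A : ℝ≥0∞)).toReal = Ar := ENNReal.coe_toReal A
  have tPi : ((Pi : ℝ≥0∞)).toReal = Pr := ENNReal.coe_toReal Pi
  have tV3 : (V ^ (1 / 3 : ℝ)).toReal = V3 := (ENNReal.toReal_rpow V _).symm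
  have tM3 : M3.toReal = Mr ^ 3 * τ := by rw [hM3def, ENNReal.toReal_mul, ENNReal.toReal_pow, tM, tτ]
  have tEτ : ((E : ℝ≥0∞) * τ').toReal = Er * τ := by rw [ENNReal.toReal_mul, tE, tτ]
  have tW2 : W2.toReal = 2 * (Er * τ) + 2 * (Mr ^ 2 * V3 * τ) := by
    rw [hW2, ENNReal.toReal_add (ENNReal.mul_ne_top (by simp) hEτfin)
      (ENNReal.mul_ne_top (by simp) (ENNReal.mul_ne_top (ENNReal.mul_ne_top (ENNReal.pow_ne_top ENNReal.coe_ne_top) hV3fin) hτ'fin))]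
    simp only [ENNReal.toReal_mul, ENNReal.toReal_pow, ENNReal.toReal_ofNat, tM, tE, tτ, tV3]
  have tΦ : Φ.toReal = Φr τ := by
    rw [hΦ, hΦr]; dsimp only
    rw [ENNReal.toReal_mul, ENNReal.toReal_mul, ENNReal.toReal_mul, ← ENNReal.toReal_rpow, ← ENNReal.toReal_rpow,
      ← ENNReal.toReal_rpow, ENNReal.toReal_add hEτfin ENNReal.coe_ne_top, tEτ, tE, tA, ENNReal.coe_toReal]
  have tWb : Wb'.toReal = Wb := by
    rw [hWb', hWb, ← ENNReal.toReal_rpow, ENNReal.toReal_add (ENNReal.mul_ne_top (by simp) ENNReal.coe_ne_top)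
      (ENNReal.mul_ne_top (by simp) (ENNReal.mul_ne_top (ENNReal.pow_ne_top ENNReal.coe_ne_top) hV3fin)),
      ENNReal.toReal_mul, ENNReal.toReal_mul, ENNReal.toReal_mul, ENNReal.toReal_pow, tE, tM, tV3]
    simp
  have tKD : KD.toReal = CDr := by
    rw [hKD, hCDr, ENNReal.toReal_mul, ENNReal.toReal_mul, tWb, ENNReal.coe_toReal, ENNReal.coe_toReal]
    ring
  have tP3 : ((Pi : ℝ≥0∞) ^ (2 / 3 : ℝ) * (4 * Φ + 4 * M3) ^ (1 / 3 : ℝ)).toReal =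
      Pr ^ (2 / 3 : ℝ) * (4 * Φr τ + 4 * (Mr ^ 3 * τ)) ^ (1 / 3 : ℝ) := by
    rw [ENNReal.toReal_mul, ← ENNReal.toReal_rpow, ← ENNReal.toReal_rpow, tPi,
      ENNReal.toReal_add (ENNReal.mul_ne_top (by simp) hΦfin) (ENNReal.mul_ne_top (by simp) hM3fin),
      ENNReal.toReal_mul (a := 4) (b := Φ), ENNReal.toReal_mul (a := 4) (b := M3), tΦ, tM3]
    simp
  have t4 : (KD * ENNReal.ofReal (4 * τ ^ (1 / 4 : ℝ))).toReal = CDr * (4 * τ ^ (1 / 4 : ℝ)) := by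
    rw [ENNReal.toReal_mul, tKD, ENNReal.toReal_ofReal (by positivity)]
  -- ### integrability and integrals of the real pieces
  have pieceInt : ∀ {q : ℝ × EuclideanSpace ℝ (Fin 3) → ℝ} {b : ℝ≥0∞},
      AEStronglyMeasurable q (volume.restrict C) → (∀ z, 0 ≤ q z) →
      (∫⁻ z in C, ENNReal.ofReal (q z)) ≤ b → b ≠ ∞ →
      IntegrableOn q C volume ∧ ∫ z in C, q z ≤ b.toReal := by
    intro q b hq hq0 hle hb
    have hfin : HasFiniteIntegral q (volume.restrict C) := by
      rw [hasFiniteIntegral_iff_enorm]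
      refine lt_of_le_of_lt (lintegral_mono fun z => le_of_eq (Real.enorm_eq_ofReal (hq0 z))) (hle.trans_lt hb.lt_top)
    refine ⟨⟨hq, hfin⟩, ?_⟩
    rw [integral_eq_lintegral_of_nonneg_ae (Eventually.of_forall hq0) hq]
    exact ENNReal.toReal_mono hb hle
  -- measurability of the real pieces
  have mw : AEStronglyMeasurable (fun z : ℝ × EuclideanSpace ℝ (Fin 3) => ‖u z.1 z.2 - e z.1 z.2‖) (volume.restrict C) := hwm.norm
  have me : AEStronglyMeasurable (fun z : ℝ × EuclideanSpace ℝ (Fin 3) => ‖e z.1 z.2‖) (volume.restrict C) := hem.norm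
  have mu : AEStronglyMeasurable (fun z : ℝ × EuclideanSpace ℝ (Fin 3) => ‖u z.1 z.2‖) (volume.restrict C) := hum.norm
  have mp : AEStronglyMeasurable (fun z : ℝ × EuclideanSpace ℝ (Fin 3) => |p z.1 z.2|) (volume.restrict C) := by
    have := hpm.norm; simpa [Real.norm_eq_abs] using this
  have mD : AEStronglyMeasurable (fun z : ℝ × EuclideanSpace ℝ (Fin 3) => ‖fderiv ℝ (e z.1) z.2‖) (volume.restrict C) := hDem.norm
  -- the eight pieces
  obtain ⟨i1, b1⟩ := pieceInt (q := fun z => cΔ * ‖u z.1 z.2 - e z.1 z.2‖ ^ 2) (b := ENNReal.ofReal cΔ * W2)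
    ((mw.pow 2).const_mul _) (fun z => by positivity) (by
      calc ∫⁻ z in C, ENNReal.ofReal (cΔ * ‖u z.1 z.2 - e z.1 z.2‖ ^ 2)
          = ENNReal.ofReal cΔ * ∫⁻ z in C, ‖u z.1 z.2 - e z.1 z.2‖ₑ ^ 2 := by
            rw [← lintegral_const_mul' _ _ ENNReal.ofReal_ne_top]
            refine lintegral_congr fun z => ?_
            rw [ENNReal.ofReal_mul hcΔ, ← ofReal_norm, ENNReal.ofReal_pow (norm_nonneg _)]
        _ ≤ _ := mul_le_mul' le_rfl I1) (ENNReal.mul_ne_top ENNReal.ofReal_ne_top hW2fin)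
  obtain ⟨i2, b2⟩ := pieceInt (q := fun z => 2 * c₁ * ((‖u z.1 z.2 - e z.1 z.2‖ ^ 2 + ‖e z.1 z.2‖ ^ 2) * ‖u z.1 z.2‖))
    (b := ENNReal.ofReal (2 * c₁) * (3 * Φ + 2 * M3))
    ((((mw.pow 2).add (me.pow 2)).mul mu).const_mul _) (fun z => by positivity) (by
      calc ∫⁻ z in C, ENNReal.ofReal (2 * c₁ * ((‖u z.1 z.2 - e z.1 z.2‖ ^ 2 + ‖e z.1 z.2‖ ^ 2) * ‖u z.1 z.2‖))
          = ENNReal.ofReal (2 * c₁) * ∫⁻ z in C, ENNReal.ofReal ((‖u z.1 z.2 - e z.1 z.2‖ ^ 2 + ‖e z.1 z.2‖ ^ 2) * ‖u z.1 z.2‖) := by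
            rw [← lintegral_const_mul' _ _ ENNReal.ofReal_ne_top]
            exact lintegral_congr fun z => ENNReal.ofReal_mul (by positivity)
        _ ≤ _ := mul_le_mul' le_rfl I2)
    (ENNReal.mul_ne_top ENNReal.ofReal_ne_top (ENNReal.add_ne_top.2 ⟨ENNReal.mul_ne_top (by simp) hΦfin,
      ENNReal.mul_ne_top (by simp) hM3fin⟩))
  obtain ⟨i3, b3⟩ := pieceInt (q := fun z => 4 * c₁ * (|p z.1 z.2| * ‖u z.1 z.2 - e z.1 z.2‖))
    (b := ENNReal.ofReal (4 * c₁) * ((Pi : ℝ≥0∞) ^ (2 / 3 : ℝ) * (4 * Φ + 4 * M3) ^ (1 / 3 : ℝ)))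
    ((mp.mul mw).const_mul _) (fun z => by positivity) (by
      calc ∫⁻ z in C, ENNReal.ofReal (4 * c₁ * (|p z.1 z.2| * ‖u z.1 z.2 - e z.1 z.2‖))
          = ENNReal.ofReal (4 * c₁) * ∫⁻ z in C, ‖p z.1 z.2‖ₑ * ‖u z.1 z.2 - e z.1 z.2‖ₑ := by
            rw [← lintegral_const_mul' _ _ ENNReal.ofReal_ne_top]
            refine lintegral_congr fun z => ?_
            rw [ENNReal.ofReal_mul (by positivity), ENNReal.ofReal_mul (abs_nonneg _), ← Real.norm_eq_abs,
              ofReal_norm, ofReal_norm]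
        _ ≤ _ := mul_le_mul' le_rfl I3)
    (ENNReal.mul_ne_top ENNReal.ofReal_ne_top (ENNReal.mul_ne_top (ENNReal.rpow_ne_top_of_nonneg (by norm_num) ENNReal.coe_ne_top)
      (ENNReal.rpow_ne_top_of_nonneg (by norm_num) (ENNReal.add_ne_top.2 ⟨ENNReal.mul_ne_top (by simp) hΦfin,
        ENNReal.mul_ne_top (by simp) hM3fin⟩))))
  obtain ⟨i4, b4⟩ := pieceInt (q := fun z => 2 * (‖fderiv ℝ (e z.1) z.2‖ * ‖e z.1 z.2‖ * ‖u z.1 z.2 - e z.1 z.2‖))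
    (b := 2 * (KD * ENNReal.ofReal (4 * τ ^ (1 / 4 : ℝ))))
    (((mD.mul me).mul mw).const_mul _) (fun z => by positivity) (by
      calc ∫⁻ z in C, ENNReal.ofReal (2 * (‖fderiv ℝ (e z.1) z.2‖ * ‖e z.1 z.2‖ * ‖u z.1 z.2 - e z.1 z.2‖))
          = 2 * ∫⁻ z in C, ‖fderiv ℝ (e z.1) z.2‖ₑ * ‖e z.1 z.2‖ₑ * ‖u z.1 z.2 - e z.1 z.2‖ₑ := by
            rw [← lintegral_const_mul' _ _ (by simp)]
            refine lintegral_congr fun z => ?_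
            rw [ENNReal.ofReal_mul (by norm_num), ENNReal.ofReal_mul (by positivity), ENNReal.ofReal_mul (norm_nonneg _),
              ofReal_norm, ofReal_norm, ofReal_norm, ENNReal.ofReal_ofNat]
        _ ≤ _ := mul_le_mul' le_rfl LDe) (ENNReal.mul_ne_top (by simp) (ENNReal.mul_ne_top hKDfin ENNReal.ofReal_ne_top))
  obtain ⟨i5, b5⟩ := pieceInt (q := fun z => 2 * c₁ * (‖e z.1 z.2‖ ^ 2 * ‖u z.1 z.2 - e z.1 z.2‖))
    (b := ENNReal.ofReal (2 * c₁) * (Φ + 2 * M3))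
    (((me.pow 2).mul mw).const_mul _) (fun z => by positivity) (by
      calc ∫⁻ z in C, ENNReal.ofReal (2 * c₁ * (‖e z.1 z.2‖ ^ 2 * ‖u z.1 z.2 - e z.1 z.2‖))
          = ENNReal.ofReal (2 * c₁) * ∫⁻ z in C, ENNReal.ofReal (‖e z.1 z.2‖ ^ 2 * ‖u z.1 z.2 - e z.1 z.2‖) := by
            rw [← lintegral_const_mul' _ _ ENNReal.ofReal_ne_top]
            exact lintegral_congr fun z => ENNReal.ofReal_mul (by positivity)
        _ ≤ _ := mul_le_mul' le_rfl I5)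
    (ENNReal.mul_ne_top ENNReal.ofReal_ne_top (ENNReal.add_ne_top.2 ⟨hΦfin, ENNReal.mul_ne_top (by simp) hM3fin⟩))
  obtain ⟨i6, b6⟩ := pieceInt (q := fun z => 2 * c₁ * ‖e z.1 z.2‖ ^ 3) (b := ENNReal.ofReal (2 * c₁) * M3)
    ((me.pow 3).const_mul _) (fun z => by positivity) (by
      calc ∫⁻ z in C, ENNReal.ofReal (2 * c₁ * ‖e z.1 z.2‖ ^ 3) = ENNReal.ofReal (2 * c₁) * ∫⁻ z in C, ‖e z.1 z.2‖ₑ ^ 3 := by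
            rw [← lintegral_const_mul' _ _ ENNReal.ofReal_ne_top]
            refine lintegral_congr fun z => ?_
            rw [ENNReal.ofReal_mul (by positivity), ← ofReal_norm, ENNReal.ofReal_pow (norm_nonneg _)]
        _ ≤ _ := mul_le_mul' le_rfl Le3) (ENNReal.mul_ne_top ENNReal.ofReal_ne_top hM3fin)
  obtain ⟨i7, b7⟩ := pieceInt (q := fun z => 4 * c₁ * (‖e z.1 z.2‖ * ‖u z.1 z.2 - e z.1 z.2‖ ^ 2))
    (b := ENNReal.ofReal (4 * c₁) * (2 * Φ + 4 * M3))
    ((me.mul (mw.pow 2)).const_mul _) (fun z => by positivity) (by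
      calc ∫⁻ z in C, ENNReal.ofReal (4 * c₁ * (‖e z.1 z.2‖ * ‖u z.1 z.2 - e z.1 z.2‖ ^ 2))
          = ENNReal.ofReal (4 * c₁) * ∫⁻ z in C, ENNReal.ofReal (‖e z.1 z.2‖ * ‖u z.1 z.2 - e z.1 z.2‖ ^ 2) := by
            rw [← lintegral_const_mul' _ _ ENNReal.ofReal_ne_top]
            exact lintegral_congr fun z => ENNReal.ofReal_mul (by positivity)
        _ ≤ _ := mul_le_mul' le_rfl I7)
    (ENNReal.mul_ne_top ENNReal.ofReal_ne_top (ENNReal.add_ne_top.2 ⟨ENNReal.mul_ne_top (by simp) hΦfin,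
      ENNReal.mul_ne_top (by simp) hM3fin⟩))
  obtain ⟨i8, b8⟩ := pieceInt (q := fun z => c₁ ^ 2 * ‖u z.1 z.2 - e z.1 z.2‖ ^ 2) (b := ENNReal.ofReal (c₁ ^ 2) * W2)
    ((mw.pow 2).const_mul _) (fun z => by positivity) (by
      calc ∫⁻ z in C, ENNReal.ofReal (c₁ ^ 2 * ‖u z.1 z.2 - e z.1 z.2‖ ^ 2)
          = ENNReal.ofReal (c₁ ^ 2) * ∫⁻ z in C, ‖u z.1 z.2 - e z.1 z.2‖ₑ ^ 2 := by
            rw [← lintegral_const_mul' _ _ ENNReal.ofReal_ne_top]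
            refine lintegral_congr fun z => ?_
            rw [ENNReal.ofReal_mul (sq_nonneg _), ← ofReal_norm, ENNReal.ofReal_pow (norm_nonneg _)]
        _ ≤ _ := mul_le_mul' le_rfl I1) (ENNReal.mul_ne_top ENNReal.ofReal_ne_top hW2fin)
  -- real forms of the eight bounds
  have hc2 : 0 ≤ 2 * c₁ := by positivity
  have hc4 : 0 ≤ 4 * c₁ := by positivity
  rw [ENNReal.toReal_mul, ENNReal.toReal_ofReal hcΔ, tW2] at b1
  rw [ENNReal.toReal_mul, ENNReal.toReal_ofReal hc2, ENNReal.toReal_add (ENNReal.mul_ne_top (by simp) hΦfin)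
    (ENNReal.mul_ne_top (by simp) hM3fin), ENNReal.toReal_mul (a := 3) (b := Φ), ENNReal.toReal_mul (a := 2) (b := M3),
    tΦ, tM3] at b2
  rw [ENNReal.toReal_mul, ENNReal.toReal_ofReal hc4, tP3] at b3
  rw [ENNReal.toReal_mul, t4] at b4
  rw [ENNReal.toReal_mul, ENNReal.toReal_ofReal hc2, ENNReal.toReal_add hΦfin (ENNReal.mul_ne_top (by simp) hM3fin),
    ENNReal.toReal_mul (a := 2) (b := M3), tΦ, tM3] at b5
  rw [ENNReal.toReal_mul, ENNReal.toReal_ofReal hc2, tM3] at b6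
  rw [ENNReal.toReal_mul, ENNReal.toReal_ofReal hc4, ENNReal.toReal_add (ENNReal.mul_ne_top (by simp) hΦfin)
    (ENNReal.mul_ne_top (by simp) hM3fin), ENNReal.toReal_mul (a := 2) (b := Φ), ENNReal.toReal_mul (a := 4) (b := M3),
    tΦ, tM3] at b7
  rw [ENNReal.toReal_mul, ENNReal.toReal_ofReal (sq_nonneg _), tW2] at b8
  simp only [ENNReal.toReal_ofNat] at b2 b4 b5 b7
  -- ### conclusion
  have iS2 := i1.fun_add i2
  have iS3 := iS2.fun_add i3
  have iS4 := iS3.fun_add i4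
  have iS5 := iS4.fun_add i5
  have iS6 := iS5.fun_add i6
  have iS7 := iS6.fun_add i7
  have iS8 := iS7.fun_add i8
  refine ⟨iS8, ?_⟩
  rw [integral_add iS7 i8, integral_add iS6 i7, integral_add iS5 i6, integral_add iS4 i5, integral_add iS3 i4,
    integral_add iS2 i3, integral_add i1 i2]
  have haτ : a τ = (cΔ + c₁ ^ 2) * (2 * (Er * τ) + 2 * (Mr ^ 2 * V3 * τ)) +
      2 * c₁ * (3 * Φr τ + 2 * (Mr ^ 3 * τ)) + 8 * c₁ * (Φr τ + 2 * (Mr ^ 3 * τ)) +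
      2 * c₁ * (Φr τ + 2 * (Mr ^ 3 * τ)) + 2 * c₁ * (Mr ^ 3 * τ) +
      4 * c₁ * (Pr ^ (2 / 3 : ℝ) * (4 * Φr τ + 4 * (Mr ^ 3 * τ)) ^ (1 / 3 : ℝ)) + 2 * (CDr * (4 * τ ^ (1 / 4 : ℝ))) := by
    simp only [ha, max_eq_left hτ.le]
  rw [haτ]
  have hΦτ : 0 ≤ Φr τ := hΦ0 τ hτ.le
  linarith [b1, b2, b3, b4, b5, b6, b7, b8, hΦτ]

end Main

end BarkerPrange2020

end Literature.Analysis.FluidPDE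

end
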